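import Summits.BirchSwinnertonDyer.BirchSwinnertonDyer.Theorems.KimAtThreeFineKatoExpStarGaloisConj
import Summits.BirchSwinnertonDyer.BirchSwinnertonDyer.Theorems.KimAtThreeFineKatoValueEquivarianceLocal
import Summits.BirchSwinnertonDyer.BirchSwinnertonDyer.Theorems.KimAtThreeFineKatoPerFactorPartsSingle
import Summits.BirchSwinnertonDyer.BirchSwinnertonDyer.Theorems.KimAtThreeFineKatoSATPointsRat
import HarnessLib

/-!
# Crux `KatoKuriharaPortThreeShared` (stmt-BirchSwinnertonDyer-19560): `ZetaBody`'s own-attribution clauses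
# (C3a)/(C3b) for the single-completion DEFINED value datum are KERNEL — the per-level discharger, assembled from
# w2-acc5's Galois bookkeeping (`KimAtThreeFineKatoValueEquivariance{,Stab,StabAll,Bridge,Local}`) and this seat's
# (GAL_loc) (`KimAtThreeFineKatoExpStarGalois`)
# (cell `bsd-addord`, seat kim3 gen 15 = the crux's LEAD; route W2 `KimAtThreeKolyvagin`; `--supports 19560`, helper)

HONEST FRAMING.  TOOL theorems only (no definition, no named fact, no `sorry`); the (DEF₀)/(RES₀) clauses, the
Prop-1.2.3 binders and `hdual` are DISPLAYED hypotheses (exactly as in hKatoV2₀ of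
`KimAtThreeFineKatoPerFactorPartsSingle`, read at an arbitrary level `(k, r)` instead of `(0, r)`); closes nothing;
nothing is booked; BSD is not proved by any of this.

WHAT.  At a level `(k, r)` of the cyclotomic tower at `p = 3` (`L = ℚ(ζ_m)`, `m = cycLevel 3 k r`), for a
Kato-stratum row, a `hdual`-normalised line datum `d` at `ℚ_{v₀}`, ANY `ℤ₃`-linear
`Λ_{k,r} : H¹(U, T₃W) → ℚ₃ ⊗ L`, any `Ψ` with the pure-tensor formula, one place `w₀ ∣ 3`, a twist family `g` with
`g̃_w • w = w₀`, a line datum `d₀` at `L_{w₀}` with (RES₀) relative to `d` and (DEF₀) for `Λ_{k,r}` on cocycles: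
* `zetaBody_C3_of_level` — **(C3a) ∧ (C3b) of `Kato2004.ZetaBody` for `Λ_{k,r}`, VERBATIM**:
  `Λ(σ · y) = (1 ⊗ σ̃) Λ(y)` for every `σ ∈ Γ_ℚ`, and `Λ y = 0` for every class dying on all `U ⊓ D_𝔓`, `𝔓 ∣ 3`.
  Proof = w2-acc5's `zetaBody_C3b_of_cocycleDef` (from (DEF₀) alone) and `zetaBody_C3a_of_cocycleDef_of_galLoc`
  ((DEF₀) + (GAL_loc)), with (GAL_loc) := this seat's `expStarOmega_galois` at `K = ℚ_{v₀}`, `L = L_{w₀}`,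
  `g := galAdicCompletionMap σ̃` (its `hg` = w2-acc5's `absClosureEmbedding_smul_eq_galAdicCompletionMap`, its
  `hgK` = `galAdicCompletionMap_algebraMap_adicCompletion`), `s` from `exists_conjTransport` (`L_{w₀}/ℚ_{v₀}` is
  Galois: w2-acc4's `isGalois_adicCompletion_cyclotomicField`), the class `h₀` with `exp*_d h₀ ≠ 0` from `hdual` +
  kim3 g12's `forall_norm_mul_padicLog_le_one_iff_three` (`dual_{ℚ₃} = ℤ₃` on the stratum), and the scalar tower
  `ℚ₃ → ℚ_{v₀} → L_{w₀}` of the CANONICAL `ℚ₃`-structures from w2-c2's `isScalarTower_padicAlgebra_of_continuous`.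
* `absGaloisRestrictTower_adicCompletion_mem_cycSubgroup_level` — the tower of `L_{w₀}` lands in the level `U`
  (kim3 g14's level-`0` lemma at every `k`).

So the supplier of hKatoV2₀ owes, for its `ZetaBody` conjunct, ONLY Kato's printed clauses (C1)(C2)(C4)(C5) once it
displays (DEF₀)/(RES₀) at every level — the LEAD's next package `hKatoP` (sequel file).

References: K. Kato, Astérisque 295 (2004) §9.4 [Kato2004Asterisque]; K. Kato, LNM 1553 (1993) II §1.2
[Kato1993LNM1553]; J. Neukirch, *ANT* (1999) I §9, II §9 (9.6) [NeukirchANT1999]; J.-P. Serre, *Local Fields* VII §5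
[SerreLocalFields1979]; S. Bloch, K. Kato (1990) §3 [BlochKato1990].
-/

noncomputable section

-- the cell's Theorems namespace `Summit.BirchSwinnertonDyer.BirchSwinnertonDyer.…` repeats the summit name by design (D-0017)
set_option linter.dupNamespace false

open scoped Classical NumberField TensorProduct ContRepresentation Pointwise
open Field ValuativeRel Function IsDedekindDomain NumberField
open WeierstrassCurve Literature.NumberTheory.EllipticCurves Literature.NumberTheory.GaloisRepresentations
  Literature.NumberTheory.GaloisRepresentations.DiscreteGaloisModule Literature.NumberTheory.GaloisCohomology
open Literature.NumberTheory.GaloisRepresentations.PeriodRingData Literature.NumberTheory.PAdicHodge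
open Literature.NumberTheory.EllipticCurves.ModularForms Literature.NumberTheory.EllipticCurves.Rank1Residual
open Literature.NumberTheory.EllipticCurves.Kato2004 Literature.NumberTheory.EllipticCurves.Kato2004.EulerSystemValues
open Literature.NumberTheory.AdelicBaseChange Literature.NumberTheory.Automorphic
open Summit.BirchSwinnertonDyer.Rank1Residual.GaloisImage
open Summit.BirchSwinnertonDyer.Rank1Residual.Additive.LocalLog
open Summit.BirchSwinnertonDyer.BirchSwinnertonDyer.Theorems
open Summit.BirchSwinnertonDyer.BirchSwinnertonDyer.Theorems.KimAtThreeFineKatoPerFactorDefined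
open Summit.BirchSwinnertonDyer.BirchSwinnertonDyer.Theorems.KimAtThreeFineKatoLevelCompat
open Summit.BirchSwinnertonDyer.BirchSwinnertonDyer.Theorems.KimAtThreeDeepLowerExpStarOmega
open Summit.BirchSwinnertonDyer.BirchSwinnertonDyer.Theorems.KimAtThreeDeepLowerExpStarOmegaPlace
open Summit.BirchSwinnertonDyer.BirchSwinnertonDyer.Theorems.KimAtThreeDeepLowerExpStarOmegaRes
open Summit.BirchSwinnertonDyer.BirchSwinnertonDyer.Theorems.KimAtThreeFineKatoPerFactorPlaces
open Summit.BirchSwinnertonDyer.BirchSwinnertonDyer.Theorems.KimAtThreeFineKatoExpStarGalois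
open Summit.BirchSwinnertonDyer.BirchSwinnertonDyer.Theorems.KimAtThreeFineKatoValueEquivarianceBridge
open Summit.BirchSwinnertonDyer.BirchSwinnertonDyer.Theorems.KimAtThreeFineKatoValueEquivarianceLocal
open Summit.BirchSwinnertonDyer.BirchSwinnertonDyer.Theorems.KimAtThreeFineKatoSATPointsRat

namespace Summit.BirchSwinnertonDyer.BirchSwinnertonDyer.Theorems.KimAtThreeFineKatoPrintClauses

/-! ### §1 The tower of `L_{w₀}` lands in the level subgroup, every `k` -/

set_option backward.isDefEq.respectTransparency false in
/-- **The tower restriction `Γ_{L_w} → Γ_{ℚ_{v₀}} → Γ_ℚ` of a completion `L_w` (`w ∣ 3`) of `L = ℚ(ζ_m)`,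
`m = cycLevel 3 k r`, lands in the level `cycSubgroup 3 k r`** (kim3 g14's level-`0` lemma
`absGaloisRestrictTower_adicCompletion_mem_cycSubgroup` at every `k`: `L_w` contains the primitive `m`-th root
`ζ_m`, so w2-acc5's `absGaloisRestrictTower_mem_cycSubgroup` applies). [cite: Rubin2000, Ch. III §2.1] -/
theorem absGaloisRestrictTower_adicCompletion_mem_cycSubgroup_level (k : ℕ) (r : Finset (HeightOneSpectrum (𝓞 ℚ)))
    (w : (((Rat.HeightOneSpectrum.primesEquiv (R := 𝓞 ℚ)).symm ⟨3, Fact.out⟩).Extension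
      (𝓞 (CyclotomicField (cycLevel 3 k r) ℚ))))
    (σ : absoluteGaloisGroup (w.1.adicCompletion (CyclotomicField (cycLevel 3 k r) ℚ))) :
    absGaloisRestrictTower ℚ (((Rat.HeightOneSpectrum.primesEquiv (R := 𝓞 ℚ)).symm ⟨3, Fact.out⟩).adicCompletion ℚ)
      (w.1.adicCompletion (CyclotomicField (cycLevel 3 k r) ℚ)) σ ∈ cycSubgroup 3 k r := by
  have hcomp : algebraMap ℚ (w.1.adicCompletion (CyclotomicField (cycLevel 3 k r) ℚ)) =
      (algebraMap (((Rat.HeightOneSpectrum.primesEquiv (R := 𝓞 ℚ)).symm ⟨3, Fact.out⟩).adicCompletion ℚ) (w.1.adicCompletion (CyclotomicField (cycLevel 3 k r) ℚ))).comp (algebraMap ℚ (((Rat.HeightOneSpectrum.primesEquiv (R := 𝓞 ℚ)).symm ⟨3, Fact.out⟩).adicCompletion ℚ)) :=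
    Subsingleton.elim _ _
  haveI hST : IsScalarTower ℚ (((Rat.HeightOneSpectrum.primesEquiv (R := 𝓞 ℚ)).symm ⟨3, Fact.out⟩).adicCompletion ℚ) (w.1.adicCompletion (CyclotomicField (cycLevel 3 k r) ℚ)) := IsScalarTower.of_algebraMap_eq' hcomp
  have hζ := ((IsCyclotomicExtension.zeta_spec (cycLevel 3 k r) ℚ
      (CyclotomicField (cycLevel 3 k r) ℚ)).map_of_injective
    (algebraMap (CyclotomicField (cycLevel 3 k r) ℚ)
      (w.1.adicCompletion (CyclotomicField (cycLevel 3 k r) ℚ))).injective)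
  exact absGaloisRestrictTower_mem_cycSubgroup 3 k r _ _ hζ σ

/-! ### §2 (C3a) ∧ (C3b) at one level, from (DEF₀) + (RES₀) + `hdual` -/

set_option maxHeartbeats 400000 in
/-- **`ZetaBody` (C3a) and (C3b) for a value datum defined through ONE completion at the level `(k, r)`**
(module docstring): VERBATIM the two own-attribution clauses of `Kato2004.ZetaBody` for `Λ_{k,r}`, from the displayed
(DEF₀)/(RES₀) for `(w₀, g, d₀)` and the `hdual`-normalised `d` on a Kato-stratum row.
[cite: Kato2004Asterisque, §9.4 (p. 188)] [cite: Kato1993LNM1553, Ch. II §1.2.4 and Prop. 1.2.3]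
[cite: NeukirchANT1999, Ch. II §9 Prop. (9.6)] [cite: SerreLocalFields1979, VII §5 Prop. 3] -/
theorem zetaBody_C3_of_level (W : WeierstrassCurve ℚ) [W.IsElliptic] [W.IsGloballyMinimal]
    [ContinuousSMul ℤ_[3] (W.tateModule 3)] [Module.Free ℤ_[3] (W.tateModule 3)]
    [Module.Finite ℤ_[3] (W.tateModule 3)]
    (hadd : haveI : Fact (Nat.Prime 3) := ⟨Nat.prime_three⟩; Addv W 3)
    (hc : ¬ 3 ∣ (W.baseChange ℚ_[3]).localTamagawaNumber ℤ_[3])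
    (ht : Nat.card {Q : (W.baseChange ℚ_[3]).toAffine.Point // (3 : ℕ) • Q = 0} = 1)
    (k : ℕ) (r : Finset (HeightOneSpectrum (𝓞 ℚ)))
    (Λkr : H1 (tateRep W 3) (cycSubgroup 3 k r) →ₗ[ℤ_[3]] ℚ_[3] ⊗[ℚ] CyclotomicField (cycLevel 3 k r) ℚ) :
    haveI : Fact (((3 : ℕ) : 𝓞 ℚ) ∈ ((Rat.HeightOneSpectrum.primesEquiv (R := 𝓞 ℚ)).symm ⟨3, Fact.out⟩).asIdeal) :=
      ⟨(natCast_mem_asIdeal_iff_eq_primesEquiv_symm _ Nat.prime_three).mpr rfl⟩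
    letI := valuativeRelPlace ((Rat.HeightOneSpectrum.primesEquiv (R := 𝓞 ℚ)).symm ⟨3, Fact.out⟩)
    letI := topologicalSpacePlace ((Rat.HeightOneSpectrum.primesEquiv (R := 𝓞 ℚ)).symm ⟨3, Fact.out⟩)
    haveI := isNonarchimedeanLocalField_place ((Rat.HeightOneSpectrum.primesEquiv (R := 𝓞 ℚ)).symm ⟨3, Fact.out⟩)
    haveI := charZero_place ((Rat.HeightOneSpectrum.primesEquiv (R := 𝓞 ℚ)).symm ⟨3, Fact.out⟩)
    letI := padicAlgebraPlace 3 ((Rat.HeightOneSpectrum.primesEquiv (R := 𝓞 ℚ)).symm ⟨3, Fact.out⟩)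
    haveI := fact_not_isUnit_place 3 ((Rat.HeightOneSpectrum.primesEquiv (R := 𝓞 ℚ)).symm ⟨3, Fact.out⟩)
    haveI := isAdicComplete_place 3 ((Rat.HeightOneSpectrum.primesEquiv (R := 𝓞 ℚ)).symm ⟨3, Fact.out⟩)
    ∀ (d : LocalNeronLineAt W 3 ((Rat.HeightOneSpectrum.primesEquiv (R := 𝓞 ℚ)).symm ⟨3, Fact.out⟩))
      (hinj : (bdRPeriodRingData (valuation_place_lt_one 3 ((Rat.HeightOneSpectrum.primesEquiv (R := 𝓞 ℚ)).symm ⟨3, Fact.out⟩))).CupLogInjective (logCyclotomic 3)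
        (localRationalTateRep W 3 (galRestrictPlace ((Rat.HeightOneSpectrum.primesEquiv (R := 𝓞 ℚ)).symm ⟨3, Fact.out⟩))))
      (hex : ∀ z : contOneCocycles (localRationalTateRep W 3 (galRestrictPlace ((Rat.HeightOneSpectrum.primesEquiv (R := 𝓞 ℚ)).symm ⟨3, Fact.out⟩))).toTopRep,
        (bdRPeriodRingData (valuation_place_lt_one 3 ((Rat.HeightOneSpectrum.primesEquiv (R := 𝓞 ℚ)).symm ⟨3, Fact.out⟩))).HasDualExp (logCyclotomic 3)
          (localRationalTateRep W 3 (galRestrictPlace ((Rat.HeightOneSpectrum.primesEquiv (R := 𝓞 ℚ)).symm ⟨3, Fact.out⟩))) fun σ => z.1 σ),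
    (∀ a : ℚ_[3], (∃ y, (expStarOmegaPadicAt d hinj hex (((Padic.adicCompletionEquiv (𝓞 ℚ) ⟨3, Fact.out⟩).symm : (((Rat.HeightOneSpectrum.primesEquiv (R := 𝓞 ℚ)).symm ⟨3, Fact.out⟩).adicCompletion ℚ) →+* ℚ_[3]))) y = a) ↔
        ∀ Q : (W.baseChange ℚ_[3]).toAffine.Point, ‖a * padicLog (W.baseChange ℚ_[3]) Q‖ ≤ 1) →
    ∀ (Ψ : ℚ_[3] ⊗[ℚ] CyclotomicField (cycLevel 3 k r) ℚ ≃ₐ[ℚ]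
      (Π w : ((Rat.HeightOneSpectrum.primesEquiv (R := 𝓞 ℚ)).symm ⟨3, Fact.out⟩).Extension
        (𝓞 (CyclotomicField (cycLevel 3 k r) ℚ)), w.1.adicCompletion (CyclotomicField (cycLevel 3 k r) ℚ)))
    (hΨ : ∀ (s : ℚ_[3]) (x : CyclotomicField (cycLevel 3 k r) ℚ)
      (w : ((Rat.HeightOneSpectrum.primesEquiv (R := 𝓞 ℚ)).symm ⟨3, Fact.out⟩).Extension
        (𝓞 (CyclotomicField (cycLevel 3 k r) ℚ))),
      Ψ (s ⊗ₜ[ℚ] x) w =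
        algebraMap (CyclotomicField (cycLevel 3 k r) ℚ) (w.1.adicCompletion (CyclotomicField (cycLevel 3 k r) ℚ)) x *
        algebraMap (((Rat.HeightOneSpectrum.primesEquiv (R := 𝓞 ℚ)).symm ⟨3, Fact.out⟩).adicCompletion ℚ)
          (w.1.adicCompletion (CyclotomicField (cycLevel 3 k r) ℚ)) ((Padic.adicCompletionEquiv (𝓞 ℚ) ⟨3, Fact.out⟩) s))
    (w₀ : ((Rat.HeightOneSpectrum.primesEquiv (R := 𝓞 ℚ)).symm ⟨3, Fact.out⟩).Extension
        (𝓞 (CyclotomicField (cycLevel 3 k r) ℚ)))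
      (g : ((Rat.HeightOneSpectrum.primesEquiv (R := 𝓞 ℚ)).symm ⟨3, Fact.out⟩).Extension
        (𝓞 (CyclotomicField (cycLevel 3 k r) ℚ)) → absoluteGaloisGroup ℚ)
      (hg : ∀ w : ((Rat.HeightOneSpectrum.primesEquiv (R := 𝓞 ℚ)).symm ⟨3, Fact.out⟩).Extension
        (𝓞 (CyclotomicField (cycLevel 3 k r) ℚ)),
        sigma (cycLevel 3 k r) (modNCyclotomicCharacter ℚ (cycLevel 3 k r) (g w)) • w.1 = w₀.1),
    letI := LocalField.charZero_adicCompletion w₀.1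
    letI := LocalField.adicCompletionPadicAlgebra w₀.1 3 (three_mem_asIdeal_extension _ w₀)
    haveI : Fact (¬ IsUnit ((3 : ℕ) : integerC (w₀.1.adicCompletion (CyclotomicField (cycLevel 3 k r) ℚ)))) :=
      ⟨not_isUnit_natCast_integerC (LocalField.valuation_adicCompletion_natCast_lt_one w₀.1 3 (three_mem_asIdeal_extension _ w₀))⟩
    haveI := isAdicComplete_integerC_natCast (LocalField.valuation_adicCompletion_natCast_lt_one w₀.1 3 (three_mem_asIdeal_extension _ w₀))
    ∀ (dw : LocalNeronLine W (LocalField.valuation_adicCompletion_natCast_lt_one w₀.1 3 (three_mem_asIdeal_extension _ w₀))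
      ((galRestrictPlace ((Rat.HeightOneSpectrum.primesEquiv (R := 𝓞 ℚ)).symm ⟨3, Fact.out⟩)).comp
        (absGaloisRestrict (((Rat.HeightOneSpectrum.primesEquiv (R := 𝓞 ℚ)).symm ⟨3, Fact.out⟩).adicCompletion ℚ) (w₀.1.adicCompletion (CyclotomicField (cycLevel 3 k r) ℚ)))))
      (hinjw : (bdRPeriodRingData (LocalField.valuation_adicCompletion_natCast_lt_one w₀.1 3 (three_mem_asIdeal_extension _ w₀))).CupLogInjective
      (logCyclotomic 3) (localRationalTateRep W 3 ((galRestrictPlace ((Rat.HeightOneSpectrum.primesEquiv (R := 𝓞 ℚ)).symm ⟨3, Fact.out⟩)).comp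
        (absGaloisRestrict (((Rat.HeightOneSpectrum.primesEquiv (R := 𝓞 ℚ)).symm ⟨3, Fact.out⟩).adicCompletion ℚ) (w₀.1.adicCompletion (CyclotomicField (cycLevel 3 k r) ℚ))))))
      (hexw : ∀ z : contOneCocycles (localRationalTateRep W 3 ((galRestrictPlace ((Rat.HeightOneSpectrum.primesEquiv (R := 𝓞 ℚ)).symm ⟨3, Fact.out⟩)).comp
        (absGaloisRestrict (((Rat.HeightOneSpectrum.primesEquiv (R := 𝓞 ℚ)).symm ⟨3, Fact.out⟩).adicCompletion ℚ) (w₀.1.adicCompletion (CyclotomicField (cycLevel 3 k r) ℚ))))).toTopRep,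
      (bdRPeriodRingData (LocalField.valuation_adicCompletion_natCast_lt_one w₀.1 3 (three_mem_asIdeal_extension _ w₀))).HasDualExp
        (logCyclotomic 3) (localRationalTateRep W 3 ((galRestrictPlace ((Rat.HeightOneSpectrum.primesEquiv (R := 𝓞 ℚ)).symm ⟨3, Fact.out⟩)).comp
        (absGaloisRestrict (((Rat.HeightOneSpectrum.primesEquiv (R := 𝓞 ℚ)).symm ⟨3, Fact.out⟩).adicCompletion ℚ) (w₀.1.adicCompletion (CyclotomicField (cycLevel 3 k r) ℚ))))) fun σ => z.1 σ),
    (∀ (h : (tateLocalRep W 3 (Sum.inr ((Rat.HeightOneSpectrum.primesEquiv (R := 𝓞 ℚ)).symm ⟨3, Fact.out⟩))).cohomology 1),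
      (expStarOmegaHom (LocalField.valuation_adicCompletion_natCast_lt_one w₀.1 3 (three_mem_asIdeal_extension _ w₀))
        ((galRestrictPlace ((Rat.HeightOneSpectrum.primesEquiv (R := 𝓞 ℚ)).symm ⟨3, Fact.out⟩)).comp
        (absGaloisRestrict (((Rat.HeightOneSpectrum.primesEquiv (R := 𝓞 ℚ)).symm ⟨3, Fact.out⟩).adicCompletion ℚ) (w₀.1.adicCompletion (CyclotomicField (cycLevel 3 k r) ℚ)))) dw hinjw hexw)
        (ContinuousRep.cohomologyRes (tateLocalRep W 3 (Sum.inr ((Rat.HeightOneSpectrum.primesEquiv (R := 𝓞 ℚ)).symm ⟨3, Fact.out⟩)))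
          (absGaloisRestrict (((Rat.HeightOneSpectrum.primesEquiv (R := 𝓞 ℚ)).symm ⟨3, Fact.out⟩).adicCompletion ℚ) (w₀.1.adicCompletion (CyclotomicField (cycLevel 3 k r) ℚ))) 1 h) =
      algebraMap (((Rat.HeightOneSpectrum.primesEquiv (R := 𝓞 ℚ)).symm ⟨3, Fact.out⟩).adicCompletion ℚ) (w₀.1.adicCompletion (CyclotomicField (cycLevel 3 k r) ℚ)) (expStarOmegaAt d h)) →
    (∀ (w : ((Rat.HeightOneSpectrum.primesEquiv (R := 𝓞 ℚ)).symm ⟨3, Fact.out⟩).Extension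
        (𝓞 (CyclotomicField (cycLevel 3 k r) ℚ)))
      (y : H1 (tateRep W 3) (cycSubgroup 3 k r))
      (φ'' : contOneCocycles (subgroupRep (tateRep W 3).toTopRep (cycSubgroup 3 k r)))
      (ψT : contOneCocycles ((tateLocalRep W 3 (Sum.inr ((Rat.HeightOneSpectrum.primesEquiv (R := 𝓞 ℚ)).symm ⟨3, Fact.out⟩))).restrict
        (absGaloisRestrict (((Rat.HeightOneSpectrum.primesEquiv (R := 𝓞 ℚ)).symm ⟨3, Fact.out⟩).adicCompletion ℚ) (w₀.1.adicCompletion (CyclotomicField (cycLevel 3 k r) ℚ)))).toTopRep),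
      oneCocycleClass _ φ'' = conjMap (tateRep W 3).toTopRep (cycSubgroup 3 k r) (g w) 1 y →
      (∀ σ, ψT.1 σ = φ''.1 ⟨absGaloisRestrictTower ℚ (((Rat.HeightOneSpectrum.primesEquiv (R := 𝓞 ℚ)).symm ⟨3, Fact.out⟩).adicCompletion ℚ) (w₀.1.adicCompletion (CyclotomicField (cycLevel 3 k r) ℚ)) σ,
        absGaloisRestrictTower_adicCompletion_mem_cycSubgroup_level k r w₀ σ⟩) →
      Ψ (Λkr y) w = galAdicCompletionMap
        (sigma (cycLevel 3 k r) (modNCyclotomicCharacter ℚ (cycLevel 3 k r) (g w)))⁻¹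
        (inv_smul_eq_of_smul_eq (hg w))
        ((expStarOmegaHom (LocalField.valuation_adicCompletion_natCast_lt_one w₀.1 3 (three_mem_asIdeal_extension _ w₀))
        ((galRestrictPlace ((Rat.HeightOneSpectrum.primesEquiv (R := 𝓞 ℚ)).symm ⟨3, Fact.out⟩)).comp
        (absGaloisRestrict (((Rat.HeightOneSpectrum.primesEquiv (R := 𝓞 ℚ)).symm ⟨3, Fact.out⟩).adicCompletion ℚ) (w₀.1.adicCompletion (CyclotomicField (cycLevel 3 k r) ℚ)))) dw hinjw hexw) (oneCocycleClass _ ψT))) →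
    (∀ (σ : absoluteGaloisGroup ℚ) (y : H1 (tateRep W 3) (cycSubgroup 3 k r)),
      Λkr (conjMap (tateRep W 3).toTopRep (cycSubgroup 3 k r) σ 1 y) =
        Algebra.TensorProduct.map (AlgHom.id ℚ ℚ_[3])
          (sigma (cycLevel 3 k r) (modNCyclotomicCharacter ℚ (cycLevel 3 k r) σ) :
            CyclotomicField (cycLevel 3 k r) ℚ →ₐ[ℚ] CyclotomicField (cycLevel 3 k r) ℚ) (Λkr y)) ∧
    (∀ (y : H1 (tateRep W 3) (cycSubgroup 3 k r)),
      (∀ v : HeightOneSpectrum (𝓞 ℚ), ((Rat.HeightOneSpectrum.primesEquiv v : Nat.Primes) : ℕ) = 3 →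
        ∀ 𝔓 ∈ v.primesAbove, resLe (tateRep W 3).toTopRep
          (inf_le_left : cycSubgroup 3 k r ⊓ MulAction.stabilizer (absoluteGaloisGroup ℚ) 𝔓 ≤ cycSubgroup 3 k r) 1 y = 0) →
      Λkr y = 0) := by
  haveI : Fact (((3 : ℕ) : 𝓞 ℚ) ∈ ((Rat.HeightOneSpectrum.primesEquiv (R := 𝓞 ℚ)).symm ⟨3, Fact.out⟩).asIdeal) :=
    ⟨(natCast_mem_asIdeal_iff_eq_primesEquiv_symm _ Nat.prime_three).mpr rfl⟩
  letI := valuativeRelPlace ((Rat.HeightOneSpectrum.primesEquiv (R := 𝓞 ℚ)).symm ⟨3, Fact.out⟩)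
  letI := topologicalSpacePlace ((Rat.HeightOneSpectrum.primesEquiv (R := 𝓞 ℚ)).symm ⟨3, Fact.out⟩)
  haveI := isNonarchimedeanLocalField_place ((Rat.HeightOneSpectrum.primesEquiv (R := 𝓞 ℚ)).symm ⟨3, Fact.out⟩)
  haveI := charZero_place ((Rat.HeightOneSpectrum.primesEquiv (R := 𝓞 ℚ)).symm ⟨3, Fact.out⟩)
  letI := padicAlgebraPlace 3 ((Rat.HeightOneSpectrum.primesEquiv (R := 𝓞 ℚ)).symm ⟨3, Fact.out⟩)
  haveI := fact_not_isUnit_place 3 ((Rat.HeightOneSpectrum.primesEquiv (R := 𝓞 ℚ)).symm ⟨3, Fact.out⟩)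
  haveI := isAdicComplete_place 3 ((Rat.HeightOneSpectrum.primesEquiv (R := 𝓞 ℚ)).symm ⟨3, Fact.out⟩)
  intro d hinj hex hdual Ψ hΨ w₀ g hg
  letI := LocalField.charZero_adicCompletion w₀.1
  letI := LocalField.adicCompletionPadicAlgebra w₀.1 3 (three_mem_asIdeal_extension _ w₀)
  haveI : Fact (¬ IsUnit ((3 : ℕ) : integerC (w₀.1.adicCompletion (CyclotomicField (cycLevel 3 k r) ℚ)))) :=
    ⟨not_isUnit_natCast_integerC (LocalField.valuation_adicCompletion_natCast_lt_one w₀.1 3 (three_mem_asIdeal_extension _ w₀))⟩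
  haveI := isAdicComplete_integerC_natCast (LocalField.valuation_adicCompletion_natCast_lt_one w₀.1 3 (three_mem_asIdeal_extension _ w₀))
  intro dw hinjw hexw hresw hdefw
  -- `Place.Completion (inr v₀)` IS `ℚ_{v₀}`: read the packet's algebra structure on it (acc5's currency)
  letI instEF : Algebra (NumberField.Place.Completion (K := ℚ) (Sum.inr ((Rat.HeightOneSpectrum.primesEquiv (R := 𝓞 ℚ)).symm ⟨3, Fact.out⟩)))
      (w₀.1.adicCompletion (CyclotomicField (cycLevel 3 k r) ℚ)) :=
    inferInstanceAs (Algebra (((Rat.HeightOneSpectrum.primesEquiv (R := 𝓞 ℚ)).symm ⟨3, Fact.out⟩).adicCompletion ℚ) (w₀.1.adicCompletion (CyclotomicField (cycLevel 3 k r) ℚ)))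
  refine ⟨?_, fun y hy => ?_⟩
  swap
  · -- (C3b) from (DEF₀) alone (w2-acc5's Bridge)
    exact zetaBody_C3b_of_cocycleDef W 3 k r Λkr Ψ w₀
      (absGaloisRestrictTower_adicCompletion_mem_cycSubgroup_level k r w₀)
      (expStarOmegaHom (LocalField.valuation_adicCompletion_natCast_lt_one w₀.1 3 (three_mem_asIdeal_extension _ w₀))
        ((galRestrictPlace ((Rat.HeightOneSpectrum.primesEquiv (R := 𝓞 ℚ)).symm ⟨3, Fact.out⟩)).comp
          (absGaloisRestrict (((Rat.HeightOneSpectrum.primesEquiv (R := 𝓞 ℚ)).symm ⟨3, Fact.out⟩).adicCompletion ℚ)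
            (w₀.1.adicCompletion (CyclotomicField (cycLevel 3 k r) ℚ)))) dw hinjw hexw)
      (fun w => (galAdicCompletionMap (sigma (cycLevel 3 k r) (modNCyclotomicCharacter ℚ (cycLevel 3 k r) (g w)))⁻¹
        (inv_smul_eq_of_smul_eq (hg w))).toAddMonoidHom) g
      (fun w y φ'' ψT hφ'' hψT => hdefw w y φ'' ψT hφ'' hψT) y hy
  -- (C3a) from (DEF₀) + (GAL_loc)
  -- Galois bookkeeping: `L_{w₀}/ℚ_{v₀}` is Galois, so conjugations by `δ' ∈ Γ_{ℚ_{v₀}}` transport to `Γ_{L_{w₀}}`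
  haveI hGal : IsGalois (NumberField.Place.Completion (K := ℚ) (Sum.inr ((Rat.HeightOneSpectrum.primesEquiv (R := 𝓞 ℚ)).symm ⟨3, Fact.out⟩)))
      (w₀.1.adicCompletion (CyclotomicField (cycLevel 3 k r) ℚ)) :=
    isGalois_adicCompletion_cyclotomicField (cycLevel 3 k r) ((Rat.HeightOneSpectrum.primesEquiv (R := 𝓞 ℚ)).symm ⟨3, Fact.out⟩) w₀
  have hconj := fun δ' : absoluteGaloisGroup (NumberField.Place.Completion (K := ℚ) (Sum.inr ((Rat.HeightOneSpectrum.primesEquiv (R := 𝓞 ℚ)).symm ⟨3, Fact.out⟩))) =>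
    exists_conjTransport (K := NumberField.Place.Completion (K := ℚ) (Sum.inr ((Rat.HeightOneSpectrum.primesEquiv (R := 𝓞 ℚ)).symm ⟨3, Fact.out⟩)))
      (L := w₀.1.adicCompletion (CyclotomicField (cycLevel 3 k r) ℚ)) δ'
  choose s hs using hconj
  -- the continuous inclusion `ℚ_{v₀} → L_{w₀}` and the scalar tower of the canonical `ℚ₃`-structures
  have hcont : Continuous (algebraMap (NumberField.Place.Completion (K := ℚ) (Sum.inr ((Rat.HeightOneSpectrum.primesEquiv (R := 𝓞 ℚ)).symm ⟨3, Fact.out⟩)))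
      (w₀.1.adicCompletion (CyclotomicField (cycLevel 3 k r) ℚ))) :=
    continuous_algebraMap (((Rat.HeightOneSpectrum.primesEquiv (R := 𝓞 ℚ)).symm ⟨3, Fact.out⟩).adicCompletion ℚ)
      (w₀.1.adicCompletion (CyclotomicField (cycLevel 3 k r) ℚ))
  haveI hSTp : IsScalarTower ℚ_[3] (NumberField.Place.Completion (K := ℚ) (Sum.inr ((Rat.HeightOneSpectrum.primesEquiv (R := 𝓞 ℚ)).symm ⟨3, Fact.out⟩)))
      (w₀.1.adicCompletion (CyclotomicField (cycLevel 3 k r) ℚ)) :=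
    isScalarTower_padicAlgebra_of_continuous 3 hcont
      (valuation_place_lt_one 3 ((Rat.HeightOneSpectrum.primesEquiv (R := 𝓞 ℚ)).symm ⟨3, Fact.out⟩))
      (LocalField.valuation_adicCompletion_natCast_lt_one w₀.1 3 (three_mem_asIdeal_extension _ w₀))
  -- one class with `exp*_d ≠ 0`: `exp*_d` reaches `1` (dual lattice `= ℤ₃` on the stratum)
  obtain ⟨y₁, hy₁⟩ := (hdual 1).2 ((forall_norm_mul_padicLog_le_one_iff_three W hadd hc ht 1).2 norm_one.le)
  have hh₀ : expStarOmega (valuation_place_lt_one 3 ((Rat.HeightOneSpectrum.primesEquiv (R := 𝓞 ℚ)).symm ⟨3, Fact.out⟩))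
      (galRestrictPlace ((Rat.HeightOneSpectrum.primesEquiv (R := 𝓞 ℚ)).symm ⟨3, Fact.out⟩)) d y₁ ≠ 0 := by
    intro h0
    rw [expStarOmegaPadicAt_apply] at hy₁
    exact one_ne_zero (hy₁.symm.trans (by rw [show expStarOmegaAt d y₁ = 0 from h0, map_zero]))
  refine zetaBody_C3a_of_cocycleDef_of_galLoc W 3 k r w₀
    (absGaloisRestrictTower_adicCompletion_mem_cycSubgroup_level k r w₀)
    (expStarOmegaHom (LocalField.valuation_adicCompletion_natCast_lt_one w₀.1 3 (three_mem_asIdeal_extension _ w₀))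
        ((galRestrictPlace ((Rat.HeightOneSpectrum.primesEquiv (R := 𝓞 ℚ)).symm ⟨3, Fact.out⟩)).comp
          (absGaloisRestrict (((Rat.HeightOneSpectrum.primesEquiv (R := 𝓞 ℚ)).symm ⟨3, Fact.out⟩).adicCompletion ℚ)
            (w₀.1.adicCompletion (CyclotomicField (cycLevel 3 k r) ℚ)))) dw hinjw hexw)
    Λkr Ψ hΨ g hg (fun w y φ'' ψT hφ'' hψT => hdefw w y φ'' ψT hφ'' hψT) (fun δ' τ => s δ' τ) hs ?_
  intro δ' hδ c c' hc'
  exact expStarOmega_galois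
    (K := NumberField.Place.Completion (K := ℚ) (Sum.inr ((Rat.HeightOneSpectrum.primesEquiv (R := 𝓞 ℚ)).symm ⟨3, Fact.out⟩)))
    (L := w₀.1.adicCompletion (CyclotomicField (cycLevel 3 k r) ℚ)) (p := 3)
    (valuation_place_lt_one 3 ((Rat.HeightOneSpectrum.primesEquiv (R := 𝓞 ℚ)).symm ⟨3, Fact.out⟩))
    (LocalField.valuation_adicCompletion_natCast_lt_one w₀.1 3 (three_mem_asIdeal_extension _ w₀)) W
    (galRestrictPlace ((Rat.HeightOneSpectrum.primesEquiv (R := 𝓞 ℚ)).symm ⟨3, Fact.out⟩)) hcont δ' (s δ') (hs δ')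
    (galAdicCompletionMap _ hδ)
    (fun x => galAdicCompletionMap_algebraMap_adicCompletion _ _ w₀ w₀ hδ x)
    (fun y x hyx => absClosureEmbedding_smul_eq_galAdicCompletionMap 3 k r w₀ δ' hδ y x hyx)
    d dw hinjw hexw (fun y => hresw y) y₁ hh₀ c c' (fun τ => hc' τ)

end Summit.BirchSwinnertonDyer.BirchSwinnertonDyer.Theorems.KimAtThreeFineKatoPrintClauses

end
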